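import Summits.Ventures.DiscreteObjects.Hadamard.CompositeOrderCRT668
import Summits.Ventures.DiscreteObjects.Hadamard.Order25TimesPrime668

/-!
# Hadamard 668 census, family F12 — NO signed automorphism of an H(668) has pair-order `369 = 9·41` (kernel, exclusion)

Framing: lottery ticket; floor = certified bounds/negative ranges.

Cell pub-namedobj (venture DiscreteObjects), target (H), hadamard gen 18.  A corollary of the order-`123` structure
(`hadamard668_order123_fpf`: an element of order `123` is fixed-point-free): if `g = (π, κ, d, e)` has pair-order `369`
then `g³` has order `123`, so `π³` fixes no row; but `g⁹` has order `41` and `π⁹` fixes exactly `12` rows (census),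
while the rows fixed by `π⁹` and not by `π³` have exact period `9` under `π`, hence number a multiple of `9` —
and `9 ∤ 12`.  **`no_hadamard668_signedAut_order_369`**, **`hadamard668_signedAut_not_dvd_orderOf_369`**.
(Orbit-type enumeration, pub-namedobj-hadamard-g18/code/cyclic_orbit_types_g18.py, one implementation: orders
`747 = 9·83`, `1503 = 9·167` are already excluded through `249`, `501` (gen 11); `27·q` for `q ∈ {13, 23, 37}` and
`5·7·11`, `3·11·13` have no admissible orbit type either — not kernel; `75`, `27`, `45`, `63`, `99`, `117`, `207`,
`333` survive the counting.)  EXCLUSION of an element order only; H(668) untouched.  Ours; no `sorry`, no definitions.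
-/

namespace Summit.Ventures.DiscreteObjects.Hadamard

open Finset BigOperators Matrix

open Literature.Combinatorics.Designs.GoethalsSeidel (IsHadamardMatrix)

variable {ι : Type*} [Fintype ι] [DecidableEq ι]

section main
variable {H : Matrix ι ι ℤ}

/-- **No signed automorphism of pair-order `369 = 9·41`.** -/
theorem no_hadamard668_signedAut_order_369 (hH : IsHadamardMatrix H) (hι : Fintype.card ι = 668)
    (π κ : Equiv.Perm ι) (d e : ι → ℤ) (haut : IsSignedAut H π κ d e)
    (hπ : π ^ 369 = 1) (hκ : κ ^ 369 = 1)
    (h123 : π ^ 123 ≠ 1 ∨ κ ^ 123 ≠ 1) (h9 : π ^ 9 ≠ 1 ∨ κ ^ 9 ≠ 1) : False := by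
  have hcard : (Fintype.card ι : ℤ) ≠ 0 := by rw [hι]; norm_num
  -- g³ has order 123: π³ fixes no row
  have haut3 := isSignedAut_pow haut 3
  have hπ3 : (π ^ 3) ^ (3 * 41) = 1 := by rw [← pow_mul]; exact hπ
  have hκ3 : (κ ^ 3) ^ (3 * 41) = 1 := by rw [← pow_mul]; exact hκ
  have hne41 : (π ^ 3) ^ 41 ≠ 1 ∨ (κ ^ 3) ^ 41 ≠ 1 := by rw [← pow_mul, ← pow_mul]; exact h123
  have hne3 : (π ^ 3) ^ 3 ≠ 1 ∨ (κ ^ 3) ^ 3 ≠ 1 := by rw [← pow_mul, ← pow_mul]; exact h9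
  obtain ⟨-, -, -, hR0⟩ := hadamard668_order123_fpf hH hι (π ^ 3) (κ ^ 3) _ _ haut3 hπ3 hκ3 hne41 hne3
  have hF3 : (univ.filter fun i => (π ^ 3) i = i).card = 0 := by
    rw [← Nat.le_zero, ← hR0]
    apply Finset.card_le_card
    intro i hi
    simp only [Finset.mem_filter, Finset.mem_univ, true_and] at hi ⊢
    exact ⟨perm_pow_apply_of_fixed _ hi 41, perm_pow_apply_of_fixed _ hi 3⟩
  -- g⁹ has order 41: π⁹ fixes 12 rows
  have haut9 := isSignedAut_pow haut 9
  have hπ9 : (π ^ 9) ^ 41 = 1 := by rw [← pow_mul]; exact hπ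
  have hκ9 : (κ ^ 9) ^ 41 = 1 := by rw [← pow_mul]; exact hκ
  have hne9 : π ^ 9 ≠ 1 := fst_pow_ne_one hH hcard haut (by decide : Odd 41) hκ9 h9
  obtain ⟨-, h12⟩ := hadamard668_signedAut_fixedRows hH hι 41 (by norm_num) (by norm_num) (π ^ 9) (κ ^ 9) _ _
    haut9 hπ9 hκ9 (Or.inl hne9)
  have hF9 : (univ.filter fun i => (π ^ 9) i = i).card = 12 := by
    rcases h12 with ⟨h, -⟩ | ⟨h, -⟩ | ⟨h, -⟩ | ⟨-, h⟩ | ⟨h, -⟩ | ⟨h, -⟩ <;> first | exact h | norm_num at h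
  -- rows fixed by π⁹ but not by π³ have exact period 9
  have hc9 := dvd_card_fixed_sq_sdiff π (by norm_num : (3 : ℕ).Prime)
  rw [show (3 : ℕ) * 3 = 9 from rfl] at hc9
  have hsplit := card_split_by_fixed (π ^ 3) (fun i => (π ^ 9) i = i)
    (fun i h => by rw [show (9 : ℕ) = 3 * 3 from rfl, pow_mul]; exact perm_pow_apply_of_fixed _ h 3)
  rw [hF9, hF3] at hsplit
  obtain ⟨k, hk⟩ := hc9
  rw [hk] at hsplit
  omega

/-- **`369 ∤ orderOf (π, κ)`** for every signed automorphism of an H(668). -/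
theorem hadamard668_signedAut_not_dvd_orderOf_369 (hH : IsHadamardMatrix H) (hι : Fintype.card ι = 668)
    (π κ : Equiv.Perm ι) (d e : ι → ℤ) (haut : IsSignedAut H π κ d e)
    (hdvd : 369 ∣ orderOf ((π, κ) : Equiv.Perm ι × Equiv.Perm ι)) : False := by
  set x : Equiv.Perm ι × Equiv.Perm ι := (π, κ) with hx
  have hx0 : orderOf x ≠ 0 := (orderOf_pos x).ne'
  set k := orderOf x / 369 with hk
  have hord : orderOf (x ^ k) = 369 := orderOf_pow_orderOf_div hx0 hdvd
  have hxk : x ^ k = ((π ^ k, κ ^ k) : Equiv.Perm ι × Equiv.Perm ι) := by rw [hx, Prod.pow_mk]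
  rw [hxk] at hord
  obtain ⟨h1, h2, h3⟩ := pow_data_of_orderOf hord (a := 123) (by norm_num) (by norm_num)
  obtain ⟨-, -, h4⟩ := pow_data_of_orderOf hord (a := 9) (by norm_num) (by norm_num)
  exact no_hadamard668_signedAut_order_369 hH hι (π ^ k) (κ ^ k) _ _ (isSignedAut_pow haut k) h1 h2 h3 h4

end main

end Summit.Ventures.DiscreteObjects.Hadamard
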